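import Summits.KontsevichZagierPeriods.KontsevichZagierPeriods.Theorems.SoloInformedTameMapFamilies
import HarnessLib

/-!
# SoloInformed — the differentiability clause of a nonlinear tame dissection is first order

Solo programme `solo-KontsevichZagierPeriods-informed`, session s138, second file of the NONLINEAR
form of COROLLARY SQ.  For a nonlinear tame shape `σ : SoloInformedTameMapShape K n N`
(file `SoloInformedTameMapFamilies`) we encode, as a `ℚ`-semialgebraic condition on the real
parameter `p`, the clause

  for every `x` in piece `i` there is a matrix `L` with `det L² = 1` such that for every `ε > 0`
  there is `δ > 0` with `(y'_j - y_j - (L (x' - x))_j)² ≤ ε² · Σ_k (x'_k - x_k)²` for all `j`,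
  whenever `x'` lies in piece `i`, `|x' - x|_∞ < δ`, `(x, y)` and `(x', y')` lie on graph `i`

— i.e. the moving map of piece `i` is differentiable WITHIN its piece at each of its points with a
Jacobian of determinant `±1`.  The clause is five alternating real quantifier blocks
`∀ x ∃ L ∀ ε ∃ δ ∀ (x', y, y')` in front of a polynomial matrix; we realise each block as one
application of the finite-block lemmas of `SoloInformedTameMapFamilies` on a tower of index types
`SoloInformedDIdx2 ⊆ … ⊆ SoloInformedDIdx5`, prove the clause `ℚ`-semialgebraic in `p`
(`isSemialgebraic_setOf_diffOK`), unfold its meaning (`diffOK_iff`), and assemble full validity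
`Valid = BasicValid ∧ ∀ i, DiffOK i` (`isSemialgebraic_setOf_valid`).

References: Bochnak–Coste–Roy (1998) §2.2, Prop. 2.9.1 (Nash functions); Basu–Pollack–Roy (2006)
§2.5.
-/

noncomputable section

namespace Summit.KontsevichZagierPeriods.KontsevichZagierPeriods.Theorems

open Set MvPolynomial Literature.ModelTheory.ExponentialFields
open Literature.NumberTheory.Transcendental

section Atoms

/-- Determinant atom at arbitrary addresses: `det (w ∘ aL)² = 1` is a polynomial equation.
[folklore] -/
theorem soloInformed_isSemialgebraic_setOf_det_sq_coord {ι : Type*} {n : ℕ}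
    (aL : Fin n × Fin n → ι) :
    IsSemialgebraic ℚ {w : ι → ℝ | (Matrix.of fun j l => w (aL (j, l))).det ^ 2 = 1} := by
  have hset : {w : ι → ℝ | (Matrix.of fun j l => w (aL (j, l))).det ^ 2 = 1} =
      {w | aeval w ((Matrix.of fun j l => (X (aL (j, l)) : MvPolynomial ι ℚ)).det ^ 2 - 1)
        = 0} := by
    ext w
    have hM : (Matrix.of fun j l => (X (aL (j, l)) : MvPolynomial ι ℚ)).map (aeval w) =
        Matrix.of fun j l => w (aL (j, l)) := by
      ext j l
      simp only [Matrix.map_apply, Matrix.of_apply, aeval_X]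
    simp only [mem_setOf_eq, map_sub, map_pow, map_one, sub_eq_zero, AlgHom.map_det,
      AlgHom.mapMatrix_apply, hM]
  rw [hset]
  exact isSemialgebraic_setOf_eval_eq_zero _

/-- First-order Taylor atom at arbitrary addresses:
`(w aY'_j - w aY_j - Σ_k w aL_(j,k) (w aX'_k - w aX_k))² ≤ (w aE)² Σ_k (w aX'_k - w aX_k)²` is a
polynomial inequality. [folklore] -/
theorem soloInformed_isSemialgebraic_setOf_taylor {ι : Type*} {n : ℕ} (aY' aY aX' aX : Fin n → ι)
    (aL : Fin n × Fin n → ι) (aE : ι) (j : Fin n) :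
    IsSemialgebraic ℚ {w : ι → ℝ | (w (aY' j) - w (aY j) -
      ∑ k, w (aL (j, k)) * (w (aX' k) - w (aX k))) ^ 2 ≤
        w aE ^ 2 * ∑ k, (w (aX' k) - w (aX k)) ^ 2} := by
  have hset : {w : ι → ℝ | (w (aY' j) - w (aY j) -
      ∑ k, w (aL (j, k)) * (w (aX' k) - w (aX k))) ^ 2 ≤
        w aE ^ 2 * ∑ k, (w (aX' k) - w (aX k)) ^ 2} =
      {w | aeval w ((X (aY' j) - X (aY j) -
          ∑ k, X (aL (j, k)) * (X (aX' k) - X (aX k))) ^ 2 : MvPolynomial ι ℚ) ≤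
        aeval w (X aE ^ 2 * ∑ k, (X (aX' k) - X (aX k)) ^ 2 : MvPolynomial ι ℚ)} := by
    ext w
    simp only [mem_setOf_eq, map_pow, map_sub, map_mul, map_sum, aeval_X]
  rw [hset]
  exact isSemialgebraic_setOf_eval_le _ _

end Atoms

/-! ### The index tower of the five quantifier blocks and its addresses -/

/-- Level 2 index: parameter, base point `x`, matrix entries `ℓ`. [folklore] -/
abbrev SoloInformedDIdx2 (K : Type*) (n : ℕ) := (K ⊕ Fin n) ⊕ (Fin n × Fin n)

/-- Level 3 index: level 2 and `ε`. [folklore] -/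
abbrev SoloInformedDIdx3 (K : Type*) (n : ℕ) := SoloInformedDIdx2 K n ⊕ Unit

/-- Level 4 index: level 3 and `δ`. [folklore] -/
abbrev SoloInformedDIdx4 (K : Type*) (n : ℕ) := SoloInformedDIdx3 K n ⊕ Unit

/-- Level 5 index: level 4 and the block `(x', y, y')`. [folklore] -/
abbrev SoloInformedDIdx5 (K : Type*) (n : ℕ) :=
  SoloInformedDIdx4 K n ⊕ (Fin n ⊕ (Fin n ⊕ Fin n))

section Addresses

variable {K : Type*} {n : ℕ}

/-- Address of the parameter block at level 5. [folklore] -/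
def soloInformedD5P : K → SoloInformedDIdx5 K n :=
  fun l => Sum.inl (Sum.inl (Sum.inl (Sum.inl (Sum.inl l))))

/-- Address of the base point `x` at level 5. [folklore] -/
def soloInformedD5X : Fin n → SoloInformedDIdx5 K n :=
  fun j => Sum.inl (Sum.inl (Sum.inl (Sum.inl (Sum.inr j))))

/-- Address of the matrix entries `ℓ` at level 5. [folklore] -/
def soloInformedD5L : Fin n × Fin n → SoloInformedDIdx5 K n :=
  fun q => Sum.inl (Sum.inl (Sum.inl (Sum.inr q)))

/-- Address of `ε` at level 5. [folklore] -/
def soloInformedD5E : SoloInformedDIdx5 K n := Sum.inl (Sum.inl (Sum.inr ()))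

/-- Address of `δ` at level 5. [folklore] -/
def soloInformedD5D : SoloInformedDIdx5 K n := Sum.inl (Sum.inr ())

/-- Address of the nearby point `x'` at level 5. [folklore] -/
def soloInformedD5X' : Fin n → SoloInformedDIdx5 K n := fun j => Sum.inr (Sum.inl j)

/-- Address of the value `y` at level 5. [folklore] -/
def soloInformedD5Y : Fin n → SoloInformedDIdx5 K n := fun j => Sum.inr (Sum.inr (Sum.inl j))

/-- Address of the value `y'` at level 5. [folklore] -/
def soloInformedD5Y' : Fin n → SoloInformedDIdx5 K n := fun j => Sum.inr (Sum.inr (Sum.inr j))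

/-- Re-addressing `(p, x')` at level 5. [folklore] -/
def soloInformedD5PX' : K ⊕ Fin n → SoloInformedDIdx5 K n :=
  Sum.elim soloInformedD5P soloInformedD5X'

/-- Re-addressing `(p, (x, y))` at level 5. [folklore] -/
def soloInformedD5PXY : K ⊕ (Fin n ⊕ Fin n) → SoloInformedDIdx5 K n :=
  Sum.elim soloInformedD5P (Sum.elim soloInformedD5X soloInformedD5Y)

/-- Re-addressing `(p, (x', y'))` at level 5. [folklore] -/
def soloInformedD5PX'Y' : K ⊕ (Fin n ⊕ Fin n) → SoloInformedDIdx5 K n :=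
  Sum.elim soloInformedD5P (Sum.elim soloInformedD5X' soloInformedD5Y')

/-! Reading the blocks off a packed level-5 vector `((((p, x), ℓ), e), d), z`. -/

variable (p : K → ℝ) (x : Fin n → ℝ) (ℓ : Fin n × Fin n → ℝ) (e d : Unit → ℝ)
  (z : Fin n ⊕ (Fin n ⊕ Fin n) → ℝ)

/-- Packed vector ∘ `(p, x')`-address. [folklore] -/
@[simp] theorem soloInformed_pack5_comp_PX' :
    (Sum.elim (Sum.elim (Sum.elim (Sum.elim (Sum.elim p x) ℓ) e) d) z) ∘ soloInformedD5PX' =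
      Sum.elim p (fun k => z (Sum.inl k)) := by
  funext t; rcases t with l | k <;> rfl

/-- Packed vector ∘ `(p, (x, y))`-address. [folklore] -/
@[simp] theorem soloInformed_pack5_comp_PXY :
    (Sum.elim (Sum.elim (Sum.elim (Sum.elim (Sum.elim p x) ℓ) e) d) z) ∘ soloInformedD5PXY =
      Sum.elim p (Sum.elim x (fun j => z (Sum.inr (Sum.inl j)))) := by
  funext t; rcases t with l | j | j <;> rfl

/-- Packed vector ∘ `(p, (x', y'))`-address. [folklore] -/
@[simp] theorem soloInformed_pack5_comp_PX'Y' :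
    (Sum.elim (Sum.elim (Sum.elim (Sum.elim (Sum.elim p x) ℓ) e) d) z) ∘ soloInformedD5PX'Y' =
      Sum.elim p (Sum.elim (fun k => z (Sum.inl k)) (fun j => z (Sum.inr (Sum.inr j)))) := by
  funext t; rcases t with l | j | j <;> rfl

/-- Packed vector at the `x`-address. [folklore] -/
@[simp] theorem soloInformed_pack5_X (k : Fin n) :
    Sum.elim (Sum.elim (Sum.elim (Sum.elim (Sum.elim p x) ℓ) e) d) z (soloInformedD5X k) = x k :=
  rfl

/-- Packed vector at the `x'`-address. [folklore] -/
@[simp] theorem soloInformed_pack5_X' (k : Fin n) :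
    Sum.elim (Sum.elim (Sum.elim (Sum.elim (Sum.elim p x) ℓ) e) d) z (soloInformedD5X' k) =
      z (Sum.inl k) := rfl

/-- Packed vector at the `y`-address. [folklore] -/
@[simp] theorem soloInformed_pack5_Y (j : Fin n) :
    Sum.elim (Sum.elim (Sum.elim (Sum.elim (Sum.elim p x) ℓ) e) d) z (soloInformedD5Y j) =
      z (Sum.inr (Sum.inl j)) := rfl

/-- Packed vector at the `y'`-address. [folklore] -/
@[simp] theorem soloInformed_pack5_Y' (j : Fin n) :
    Sum.elim (Sum.elim (Sum.elim (Sum.elim (Sum.elim p x) ℓ) e) d) z (soloInformedD5Y' j) =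
      z (Sum.inr (Sum.inr j)) := rfl

/-- Packed vector at the `ℓ`-address. [folklore] -/
@[simp] theorem soloInformed_pack5_L (q : Fin n × Fin n) :
    Sum.elim (Sum.elim (Sum.elim (Sum.elim (Sum.elim p x) ℓ) e) d) z (soloInformedD5L q) = ℓ q :=
  rfl

/-- Packed vector at the `ε`-address. [folklore] -/
@[simp] theorem soloInformed_pack5_E :
    Sum.elim (Sum.elim (Sum.elim (Sum.elim (Sum.elim p x) ℓ) e) d) z soloInformedD5E = e () :=
  rfl

/-- Packed vector at the `δ`-address. [folklore] -/
@[simp] theorem soloInformed_pack5_D :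
    Sum.elim (Sum.elim (Sum.elim (Sum.elim (Sum.elim p x) ℓ) e) d) z soloInformedD5D = d () :=
  rfl

end Addresses

namespace SoloInformedTameMapShape

variable {K : Type*} {n N : ℕ} (σ : SoloInformedTameMapShape K n N)

/-! ### The five levels -/

/-- Level 5 matrix (innermost, quantifier-free): if `x'` lies in piece `i` within `δ` of `x` and
`(x, y)`, `(x', y')` lie on graph `i`, then the first-order Taylor estimate with slope `ℓ` and
tolerance `ε` holds coordinatewise. [folklore] -/
def diff5 (i : Fin N) : Set (SoloInformedDIdx5 K n → ℝ) :=
  {w | w ∘ soloInformedD5PX' ∈ σ.S i →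
    (∀ k, w (soloInformedD5X' k) - w (soloInformedD5X k) < w soloInformedD5D ∧
      w (soloInformedD5X k) - w (soloInformedD5X' k) < w soloInformedD5D) →
    w ∘ soloInformedD5PXY ∈ σ.G i → w ∘ soloInformedD5PX'Y' ∈ σ.G i →
    ∀ j, (w (soloInformedD5Y' j) - w (soloInformedD5Y j) -
      ∑ k, w (soloInformedD5L (j, k)) * (w (soloInformedD5X' k) - w (soloInformedD5X k))) ^ 2 ≤
        w soloInformedD5E ^ 2 * ∑ k, (w (soloInformedD5X' k) - w (soloInformedD5X k)) ^ 2}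

/-- Level 4: `δ > 0` and the level-5 matrix for all `(x', y, y')`. [folklore] -/
def diff4 (i : Fin N) : Set (SoloInformedDIdx4 K n → ℝ) :=
  {u | 0 < u (Sum.inr ()) ∧ ∀ z : Fin n ⊕ (Fin n ⊕ Fin n) → ℝ, Sum.elim u z ∈ σ.diff5 i}

/-- Level 3: if `ε > 0` then some `δ` works. [folklore] -/
def diff3 (i : Fin N) : Set (SoloInformedDIdx3 K n → ℝ) :=
  {u | 0 < u (Sum.inr ()) → ∃ d : Unit → ℝ, Sum.elim u d ∈ σ.diff4 i}

/-- Level 2: `det ℓ² = 1` and every `ε` is served. [folklore] -/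
def diff2 (i : Fin N) : Set (SoloInformedDIdx2 K n → ℝ) :=
  {u | (Matrix.of fun j l => u (Sum.inr (j, l))).det ^ 2 = 1 ∧
    ∀ e : Unit → ℝ, Sum.elim u e ∈ σ.diff3 i}

/-- Level 1: if `x` lies in piece `i` then some slope matrix `ℓ` works. [folklore] -/
def diff1 (i : Fin N) : Set (K ⊕ Fin n → ℝ) :=
  {u | u ∈ σ.S i → ∃ ℓ : Fin n × Fin n → ℝ, Sum.elim u ℓ ∈ σ.diff2 i}

/-- **The differentiability clause** for piece `i` at parameter `p`: the moving map of piece `i`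
is differentiable within the piece at each of its points, with Jacobian determinant `±1`.
[folklore] -/
def DiffOK (i : Fin N) (p : K → ℝ) : Prop := ∀ x : Fin n → ℝ, Sum.elim p x ∈ σ.diff1 i

/-- **Validity** of the parameter `p` for the source `D₀`: basic validity and the
differentiability clause for every piece. [folklore] -/
def Valid (D₀ : Set (Fin n → ℝ)) (p : K → ℝ) : Prop := σ.BasicValid D₀ p ∧ ∀ i, σ.DiffOK i p

/-! ### Semialgebraicity, level by level -/

variable {i : Fin N}

/-- Level 5 is `ℚ`-semialgebraic. [cite: BochnakCosteRoy1998, §2.2] -/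
theorem isSemialgebraic_diff5 (hS : IsSemialgebraic ℚ (σ.S i)) (hG : IsSemialgebraic ℚ (σ.G i)) :
    IsSemialgebraic ℚ (σ.diff5 i) :=
  soloInformed_isSemialgebraic_setOf_imp (hS.preimage_comp _)
    (soloInformed_isSemialgebraic_setOf_imp
      (soloInformed_isSemialgebraic_setOf_forall fun k => soloInformed_isSemialgebraic_setOf_and
        (soloInformed_isSemialgebraic_setOf_coord_sub_lt _ _ _)
        (soloInformed_isSemialgebraic_setOf_coord_sub_lt (soloInformedD5X k) _ _))
      (soloInformed_isSemialgebraic_setOf_imp (hG.preimage_comp _)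
        (soloInformed_isSemialgebraic_setOf_imp (hG.preimage_comp _)
          (soloInformed_isSemialgebraic_setOf_forall fun j =>
            soloInformed_isSemialgebraic_setOf_taylor _ _ _ _ _ _ j))))

/-- Level 4 is `ℚ`-semialgebraic (a universal block). [cite: BochnakCosteRoy1998, Prop. 2.2.4] -/
theorem isSemialgebraic_diff4 [Finite K] (hS : IsSemialgebraic ℚ (σ.S i))
    (hG : IsSemialgebraic ℚ (σ.G i)) : IsSemialgebraic ℚ (σ.diff4 i) :=
  soloInformed_isSemialgebraic_setOf_and (soloInformed_isSemialgebraic_setOf_coord_pos _)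
    (soloInformed_isSemialgebraic_setOf_forall_block (σ.isSemialgebraic_diff5 hS hG)
      fun _ => Iff.rfl)

/-- Level 3 is `ℚ`-semialgebraic (an existential block). [cite: BochnakCosteRoy1998, Prop. 2.2.4] -/
theorem isSemialgebraic_diff3 [Finite K] (hS : IsSemialgebraic ℚ (σ.S i))
    (hG : IsSemialgebraic ℚ (σ.G i)) : IsSemialgebraic ℚ (σ.diff3 i) :=
  soloInformed_isSemialgebraic_setOf_imp (soloInformed_isSemialgebraic_setOf_coord_pos _)
    (soloInformed_isSemialgebraic_setOf_exists_block (σ.isSemialgebraic_diff4 hS hG)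
      fun _ => Iff.rfl)

/-- Level 2 is `ℚ`-semialgebraic (a universal block). [cite: BochnakCosteRoy1998, Prop. 2.2.4] -/
theorem isSemialgebraic_diff2 [Finite K] (hS : IsSemialgebraic ℚ (σ.S i))
    (hG : IsSemialgebraic ℚ (σ.G i)) : IsSemialgebraic ℚ (σ.diff2 i) :=
  soloInformed_isSemialgebraic_setOf_and (soloInformed_isSemialgebraic_setOf_det_sq_coord _)
    (soloInformed_isSemialgebraic_setOf_forall_block (σ.isSemialgebraic_diff3 hS hG)
      fun _ => Iff.rfl)

/-- Level 1 is `ℚ`-semialgebraic (an existential block). [cite: BochnakCosteRoy1998, Prop. 2.2.4] -/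
theorem isSemialgebraic_diff1 [Finite K] (hS : IsSemialgebraic ℚ (σ.S i))
    (hG : IsSemialgebraic ℚ (σ.G i)) : IsSemialgebraic ℚ (σ.diff1 i) :=
  soloInformed_isSemialgebraic_setOf_imp hS
    (soloInformed_isSemialgebraic_setOf_exists_block (σ.isSemialgebraic_diff2 hS hG)
      fun _ => Iff.rfl)

/-- **The differentiability clause is `ℚ`-semialgebraic in the parameter.**
[cite: BochnakCosteRoy1998, Prop. 2.2.4] -/
theorem isSemialgebraic_setOf_diffOK [Finite K] (hS : IsSemialgebraic ℚ (σ.S i))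
    (hG : IsSemialgebraic ℚ (σ.G i)) : IsSemialgebraic ℚ {p : K → ℝ | σ.DiffOK i p} :=
  soloInformed_isSemialgebraic_setOf_forall_block (σ.isSemialgebraic_diff1 hS hG) fun _ => Iff.rfl

/-- **Validity is `ℚ`-semialgebraic in the parameter.** [cite: BochnakCosteRoy1998, Prop. 2.2.4] -/
theorem isSemialgebraic_setOf_valid [Finite K] {D₀ : Set (Fin n → ℝ)}
    (hS : ∀ i, IsSemialgebraic ℚ (σ.S i)) (hG : ∀ i, IsSemialgebraic ℚ (σ.G i))
    (hD₀ : IsSemialgebraic ℚ D₀) : IsSemialgebraic ℚ {p : K → ℝ | σ.Valid D₀ p} :=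
  soloInformed_isSemialgebraic_setOf_and (σ.isSemialgebraic_setOf_basicValid hS hG hD₀)
    (soloInformed_isSemialgebraic_setOf_forall fun i =>
      σ.isSemialgebraic_setOf_diffOK (hS i) (hG i))

/-! ### What the differentiability clause says -/

/-- **Semantic unfolding of the differentiability clause.** [folklore] -/
theorem diffOK_iff {i : Fin N} {p : K → ℝ} : σ.DiffOK i p ↔
    ∀ x ∈ σ.piece i p, ∃ ℓ : Fin n × Fin n → ℝ, (Matrix.of fun j k => ℓ (j, k)).det ^ 2 = 1 ∧
      ∀ e : ℝ, 0 < e → ∃ d : ℝ, 0 < d ∧ ∀ x' y y' : Fin n → ℝ, x' ∈ σ.piece i p →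
        (∀ k, x' k - x k < d ∧ x k - x' k < d) → σ.rel i p x y → σ.rel i p x' y' →
        ∀ j, (y' j - y j - ∑ k, ℓ (j, k) * (x' k - x k)) ^ 2 ≤ e ^ 2 * ∑ k, (x' k - x k) ^ 2 := by
  simp only [DiffOK, diff1, diff2, diff3, diff4, diff5, piece, rel, mem_setOf_eq, Sum.elim_inr,
    soloInformed_pack5_comp_PX', soloInformed_pack5_comp_PXY, soloInformed_pack5_comp_PX'Y',
    soloInformed_pack5_X, soloInformed_pack5_X', soloInformed_pack5_Y, soloInformed_pack5_Y',
    soloInformed_pack5_L, soloInformed_pack5_E, soloInformed_pack5_D]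
  refine forall_congr' fun x => imp_congr_right fun _ => exists_congr fun ℓ =>
    and_congr_right fun _ => ⟨fun h e he => ?_, fun h e he => ?_⟩
  · obtain ⟨d, hd, hz⟩ := h (fun _ => e) he
    refine ⟨d (), hd, fun x' y y' hx' hcl hy hy' => ?_⟩
    simpa using hz (Sum.elim x' (Sum.elim y y')) (by simpa using hx') hcl (by simpa using hy)
      (by simpa using hy')
  · obtain ⟨d, hd, hz⟩ := h (e ()) he
    exact ⟨fun _ => d, hd, fun z hx' hcl hy hy' => hz _ _ _ hx' hcl hy hy'⟩

/-- The two halves of validity. [folklore] -/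
theorem Valid.basic {D₀ : Set (Fin n → ℝ)} {p : K → ℝ} (h : σ.Valid D₀ p) : σ.BasicValid D₀ p :=
  h.1

/-- The two halves of validity. [folklore] -/
theorem Valid.diffOK {D₀ : Set (Fin n → ℝ)} {p : K → ℝ} (h : σ.Valid D₀ p) (i : Fin N) :
    σ.DiffOK i p :=
  h.2 i

end SoloInformedTameMapShape

end Summit.KontsevichZagierPeriods.KontsevichZagierPeriods.Theorems
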